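import Literature.NumberTheory.Automorphic.WhittakerBesselGL2
import Literature.NumberTheory.Automorphic.HaarIntegralClosedCompactProofs
import Literature.NumberTheory.Automorphic.ClosedCompactDecomposition
import Literature.NumberTheory.Automorphic.IwasawaDecompositionAdelic
import Literature.NumberTheory.Automorphic.GLnMaximalCompactCompact
import Literature.NumberTheory.Automorphic.AutomorphicRepsGLCuspFormsRapidDecay
import Literature.NumberTheory.Automorphic.IdelicDyadicUnfolding
import HarnessLib

/-!
# Haar measure on `GL₂(𝔸_K)` in Iwasawa coordinates

Topic `NumberTheory/Automorphic`; namespace `Literature.NumberTheory.Automorphic`. A brick of the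
mean-square route to Jacquet–Shalika's Theorem (5.3) for `GL₂`
(`StandardLFunctionData.multipliable_L`; files `WhittakerBesselGL2`, `IdelicDyadicUnfolding`,
`InvariantMeasureDominationExplicit`): the Haar measure of `G = GL₂(𝔸_K)` in the coordinates
`g = d(a₁, a₂) · u · k` of the Iwasawa decomposition `G = B K` (`B` the upper triangular Borel
subgroup, `K = K_∞ · GL₂(𝒪̂_K)`, `iwasawaDecomposition_gl_adelic_holds` of
`IwasawaDecompositionAdelic`), and the Jacobian of the torus acting on `N₂(𝔸_K)`:

* `borelCoordGL2`, `borelHomeomorphGL2` — **`B ≅ (Rˣ × Rˣ) × N₂`** over any (topological)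
  commutative ring, `((a₁,a₂),u) ↦ d(a₁,a₂) u` with inverse `b ↦ ((b₀₀, b₁₁), d(b)⁻¹ b)`;
  `torusConjGL2 a u = d(a)⁻¹ u d(a) = n(a₁⁻¹ u₀₁ a₂)` and the group law in coordinates
  (`borelCoordGL2_mul`);
* `map_constSMul_eq_distribHaarChar_inv_smul`, `lintegral_comp_constSMul_eq` — for an additive Haar
  measure `μ` and `g` acting distributively, `(g • ·)_* μ = Δ(g⁻¹) μ` (Mathlib `distribHaarChar`);
* `borelMeasureGL2 K μI ν`, `isHaarMeasure_borelMeasureGL2` — **`μ_I ⊗ μ_I ⊗ ν` in Borel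
  coordinates is a left Haar measure on `B(𝔸_K)`** (`μ_I` a Haar measure of the idele group, `ν`
  one of `N₂(𝔸_K)`): left translations are skew products of a translation of `(𝔸_Kˣ)²` with
  fibrewise left translations of `N₂(𝔸_K)` (Mathlib `MeasurePreserving.skew_product`);
* `lintegral_eq_iwasawa` — **`∫_G f dμ_G = c ∫∫∫∫ f(d(a₁,a₂) u k) dμ_K dν dμ_I dμ_I`** with
  `c = iwasawaConstGL2 > 0`, from `HaarHK.eq_smul_map_prod` (`μ_G = c · a_*(μ_B ⊗ μ_K)` for
  `G = B K`, `HaarIntegralClosedCompactProofs`) and the inversion invariance of the Haar measure of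
  the compact group `K`;
* `lintegral_comp_torusConjGL2` — **`∫ F(d(a)⁻¹ u d(a)) dν(u) = Δ(a₁/a₂) ∫ F dν`**, `Δ` the module
  of `𝔸_K`, through `N₂(𝔸_K) ≅ 𝔸_K` (`entryMeasure` of `WhittakerBesselGL2`);
  `lintegral_unipotent_torus_eq` — the same in the form
  `∫∫ f(u d(a) k) = Δ(a₁/a₂) ∫∫ f(d(a) u k)` (the Jacobian `y⁻¹` of `dg = y⁻¹ dx d×y₁ d×y₂ dk`,
  `g = n(x) diag(y₁,y₂) k`, `y = y₁/y₂`, in `GL₂(ℝ)`).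

Everything is proved; folklore (Haar measure of `GL₂` over local and adelic rings in Iwasawa
coordinates: Bump, *Automorphic Forms and Representations* (1997), §2.1 (Prop. 2.1.5) and §3.8;
Getz–Hahn (2024), Prop. 3.2.3 and Ex. 3.1; Godement–Jacquet (1972), §10; Deitmar–Echterhoff (2014),
Prop. 1.5.6 for the `G = B K` step).

## References

* D. Bump, *Automorphic Forms and Representations*, Cambridge Stud. Adv. Math. 55 (1997), §2.1,
  §3.8 [Bump1997].
* J. R. Getz, H. Hahn, *An Introduction to Automorphic Representations*, GTM 300 (2024), §3.2
  [GetzHahn2024].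
* A. Deitmar, S. Echterhoff, *Principles of Harmonic Analysis*, 2nd ed. (2014), Prop. 1.5.6
  [DeitmarEchterhoff2014].
-/

noncomputable section

open MeasureTheory Measure NumberField IsDedekindDomain Matrix Set Filter
open scoped MatrixGroups ENNReal NNReal Pointwise Topology

namespace Literature.NumberTheory.Automorphic

/-! ### The Borel subgroup of `GL₂` in coordinates `B = T · N` -/

section Ring

variable {R : Type*} [CommRing R]

/-- Membership in the upper triangular Borel subgroup of `GL₂(R)` (`standardParabolicGL R id`):
`g ∈ B ↔ g₁₀ = 0`. [folklore] -/
theorem mem_standardParabolicGL_fin_two_iff {g : GL (Fin 2) R} :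
    g ∈ standardParabolicGL R (id : Fin 2 → Fin 2) ↔ (g : Matrix (Fin 2) (Fin 2) R) 1 0 = 0 := by
  rw [mem_standardParabolicGL_iff]
  constructor
  · intro h; exact h (show (id 0 : Fin 2) < id 1 by decide)
  · intro h i j hij
    fin_cases i <;> fin_cases j
    · exact absurd hij (lt_irrefl _)
    · exact absurd hij (by decide)
    · exact h
    · exact absurd hij (lt_irrefl _)

/-- `d(a, b)⁻¹ = d(a⁻¹, b⁻¹)`. [folklore] -/
theorem diagGL2_inv (a b : Rˣ) : (diagGL2 a b)⁻¹ = diagGL2 a⁻¹ b⁻¹ := by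
  rw [inv_eq_iff_mul_eq_one, ← diagGL2_mul, mul_inv_cancel, mul_inv_cancel, diagGL2_one]

/-- `d(a, b)` is upper triangular. [folklore] -/
theorem diagGL2_mem_standardParabolicGL (a b : Rˣ) :
    diagGL2 a b ∈ standardParabolicGL R (id : Fin 2 → Fin 2) := by
  rw [mem_standardParabolicGL_fin_two_iff, coe_diagGL2]; rfl

/-- `N₂ ≤ B`. [folklore] -/
theorem upperUnitriangular_le_standardParabolicGL_fin_two :
    upperUnitriangular (Fin 2) R ≤ standardParabolicGL R (id : Fin 2 → Fin 2) :=
  fun _ hu => ((mem_upperUnitriangular_iff _).1 hu).1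

/-- **The torus normalises `N₂`**: `d(a,b)⁻¹ n(x) d(a,b) = n(a⁻¹ x b)`. [folklore] -/
theorem diagGL2_inv_mul_unipotentGL2_mul_diagGL2 (a b : Rˣ) (x : R) :
    (diagGL2 a b)⁻¹ * ((unipotentGL2 x : ↥(upperUnitriangular (Fin 2) R)) : GL (Fin 2) R) * diagGL2 a b =
      ((unipotentGL2 (((a⁻¹ : Rˣ) : R) * x * b) : ↥(upperUnitriangular (Fin 2) R)) : GL (Fin 2) R) := by
  rw [diagGL2_inv]
  refine Units.ext ?_
  rw [Units.val_mul, Units.val_mul, coe_diagGL2, coe_unipotentGL2, coe_unipotentGL2, coe_diagGL2]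
  ext i j
  fin_cases i <;> fin_cases j <;> simp [Matrix.mul_apply, Fin.sum_univ_two]

/-- **Conjugation of `N₂` by the torus**, as a map `N₂ → N₂`: `u ↦ d(a)⁻¹ u d(a)`. [folklore] -/
def torusConjGL2 (a : Rˣ × Rˣ) (u : ↥(upperUnitriangular (Fin 2) R)) : ↥(upperUnitriangular (Fin 2) R) :=
  unipotentGL2 (((a.1⁻¹ : Rˣ) : R) * ((u : GL (Fin 2) R) : Matrix (Fin 2) (Fin 2) R) 0 1 * a.2)

/-- `d(a)⁻¹ u d(a) = torusConjGL2 a u` in `GL₂(R)`. [folklore] -/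
theorem coe_torusConjGL2 (a : Rˣ × Rˣ) (u : ↥(upperUnitriangular (Fin 2) R)) :
    ((torusConjGL2 a u : ↥(upperUnitriangular (Fin 2) R)) : GL (Fin 2) R) =
      (diagGL2 a.1 a.2)⁻¹ * (u : GL (Fin 2) R) * diagGL2 a.1 a.2 := by
  conv_rhs => rw [← unipotentGL2_entry u]
  rw [diagGL2_inv_mul_unipotentGL2_mul_diagGL2]; rfl

/-- The `(0,1)` entry of `torusConjGL2 a u` is `a₁⁻¹ u₀₁ a₂`. [folklore] -/
theorem torusConjGL2_apply_zero_one (a : Rˣ × Rˣ) (u : ↥(upperUnitriangular (Fin 2) R)) :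
    (((torusConjGL2 a u : ↥(upperUnitriangular (Fin 2) R)) : GL (Fin 2) R) : Matrix (Fin 2) (Fin 2) R) 0 1 =
      ((a.1⁻¹ : Rˣ) : R) * ((u : GL (Fin 2) R) : Matrix (Fin 2) (Fin 2) R) 0 1 * a.2 :=
  unipotentGL2_apply_zero_one _

/-- `d(a) · torusConjGL2 a u = u · d(a)`. [folklore] -/
theorem diagGL2_mul_torusConjGL2 (a : Rˣ × Rˣ) (u : ↥(upperUnitriangular (Fin 2) R)) :
    diagGL2 a.1 a.2 * ((torusConjGL2 a u : ↥(upperUnitriangular (Fin 2) R)) : GL (Fin 2) R) =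
      (u : GL (Fin 2) R) * diagGL2 a.1 a.2 := by
  rw [coe_torusConjGL2, ← mul_assoc, ← mul_assoc, mul_inv_cancel, one_mul]

/-- `torusConjGL2 a` is multiplicative. [folklore] -/
theorem torusConjGL2_mul (a : Rˣ × Rˣ) (u v : ↥(upperUnitriangular (Fin 2) R)) :
    torusConjGL2 a (u * v) = torusConjGL2 a u * torusConjGL2 a v := by
  refine Subtype.ext ?_
  rw [Subgroup.coe_mul, coe_torusConjGL2, coe_torusConjGL2, coe_torusConjGL2, Subgroup.coe_mul]
  group

/-- `torusConjGL2 a` has inverse `torusConjGL2 a⁻¹`. [folklore] -/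
theorem torusConjGL2_inv_apply (a : Rˣ × Rˣ) (u : ↥(upperUnitriangular (Fin 2) R)) :
    torusConjGL2 a⁻¹ (torusConjGL2 a u) = u := by
  refine Subtype.ext ?_
  rw [coe_torusConjGL2, coe_torusConjGL2, Prod.fst_inv, Prod.snd_inv, ← diagGL2_inv, inv_inv]
  group

/-- The diagonal of an upper triangular invertible `2 × 2` matrix: its entries `b₀₀, b₁₁` as units
(with inverses the diagonal entries of `b⁻¹`). [folklore] -/
def borelDiagGL2 (b : ↥(standardParabolicGL R (id : Fin 2 → Fin 2))) : Rˣ × Rˣ :=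
  (⟨((b : GL (Fin 2) R) : Matrix (Fin 2) (Fin 2) R) 0 0, (((b : GL (Fin 2) R)⁻¹ : GL (Fin 2) R) : Matrix (Fin 2) (Fin 2) R) 0 0,
    by
      have h := congrFun (congrFun (Units.mul_inv (b : GL (Fin 2) R)) 0) 0
      rw [Matrix.mul_apply, Fin.sum_univ_two, Matrix.one_apply_eq] at h
      have h10 : (((b : GL (Fin 2) R)⁻¹ : GL (Fin 2) R) : Matrix (Fin 2) (Fin 2) R) 1 0 = 0 :=
        mem_standardParabolicGL_fin_two_iff.1 (inv_mem b.2)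
      rwa [h10, mul_zero, add_zero] at h,
    by
      have h := congrFun (congrFun (Units.inv_mul (b : GL (Fin 2) R)) 0) 0
      rw [Matrix.mul_apply, Fin.sum_univ_two, Matrix.one_apply_eq] at h
      have h10 : ((b : GL (Fin 2) R) : Matrix (Fin 2) (Fin 2) R) 1 0 = 0 :=
        mem_standardParabolicGL_fin_two_iff.1 b.2
      rwa [h10, mul_zero, add_zero] at h⟩,
   ⟨((b : GL (Fin 2) R) : Matrix (Fin 2) (Fin 2) R) 1 1, (((b : GL (Fin 2) R)⁻¹ : GL (Fin 2) R) : Matrix (Fin 2) (Fin 2) R) 1 1,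
    by
      have h := congrFun (congrFun (Units.mul_inv (b : GL (Fin 2) R)) 1) 1
      rw [Matrix.mul_apply, Fin.sum_univ_two, Matrix.one_apply_eq] at h
      have h10 : ((b : GL (Fin 2) R) : Matrix (Fin 2) (Fin 2) R) 1 0 = 0 :=
        mem_standardParabolicGL_fin_two_iff.1 b.2
      rwa [h10, zero_mul, zero_add] at h,
    by
      have h := congrFun (congrFun (Units.inv_mul (b : GL (Fin 2) R)) 1) 1
      rw [Matrix.mul_apply, Fin.sum_univ_two, Matrix.one_apply_eq] at h
      have h10 : (((b : GL (Fin 2) R)⁻¹ : GL (Fin 2) R) : Matrix (Fin 2) (Fin 2) R) 1 0 = 0 :=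
        mem_standardParabolicGL_fin_two_iff.1 (inv_mem b.2)
      rwa [h10, zero_mul, zero_add] at h⟩)

/-- The first diagonal unit of `b` is `b₀₀`. [folklore] -/
@[simp] theorem coe_borelDiagGL2_fst (b : ↥(standardParabolicGL R (id : Fin 2 → Fin 2))) :
    ((borelDiagGL2 b).1 : R) = ((b : GL (Fin 2) R) : Matrix (Fin 2) (Fin 2) R) 0 0 := rfl

/-- The second diagonal unit of `b` is `b₁₁`. [folklore] -/
@[simp] theorem coe_borelDiagGL2_snd (b : ↥(standardParabolicGL R (id : Fin 2 → Fin 2))) :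
    ((borelDiagGL2 b).2 : R) = ((b : GL (Fin 2) R) : Matrix (Fin 2) (Fin 2) R) 1 1 := rfl

/-- The unipotent part `d(b)⁻¹ b ∈ N₂` of an upper triangular `b`. [folklore] -/
def borelUnipGL2 (b : ↥(standardParabolicGL R (id : Fin 2 → Fin 2))) : ↥(upperUnitriangular (Fin 2) R) :=
  ⟨(diagGL2 (borelDiagGL2 b).1 (borelDiagGL2 b).2)⁻¹ * (b : GL (Fin 2) R), by
    have h10 : ((b : GL (Fin 2) R) : Matrix (Fin 2) (Fin 2) R) 1 0 = 0 :=
      mem_standardParabolicGL_fin_two_iff.1 b.2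
    rw [mem_upperUnitriangular_iff, diagGL2_inv, Units.val_mul, coe_diagGL2]
    refine ⟨fun i j hij => ?_, fun i => ?_⟩
    · fin_cases i <;> fin_cases j
      · exact absurd hij (lt_irrefl _)
      · exact absurd hij (by decide)
      · simp [Matrix.mul_apply, Fin.sum_univ_two, h10]
      · exact absurd hij (lt_irrefl _)
    · fin_cases i
      · simp [Matrix.mul_apply, Fin.sum_univ_two]
      · simp [Matrix.mul_apply, Fin.sum_univ_two]⟩

/-- `d(b) · (d(b)⁻¹ b) = b`. [folklore] -/
theorem diagGL2_mul_borelUnipGL2 (b : ↥(standardParabolicGL R (id : Fin 2 → Fin 2))) :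
    diagGL2 (borelDiagGL2 b).1 (borelDiagGL2 b).2 * ((borelUnipGL2 b : ↥(upperUnitriangular (Fin 2) R)) : GL (Fin 2) R) =
      (b : GL (Fin 2) R) :=
  mul_inv_cancel_left _ _

/-- **Coordinates `B = T × N` on the Borel subgroup of `GL₂`**: `((a₁, a₂), u) ↦ d(a₁, a₂) u`,
with inverse `b ↦ ((b₀₀, b₁₁), d(b)⁻¹ b)`. [folklore] -/
def borelCoordGL2 : (Rˣ × Rˣ) × ↥(upperUnitriangular (Fin 2) R) ≃ ↥(standardParabolicGL R (id : Fin 2 → Fin 2)) where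
  toFun p := ⟨diagGL2 p.1.1 p.1.2 * (p.2 : GL (Fin 2) R),
    mul_mem (diagGL2_mem_standardParabolicGL _ _) (upperUnitriangular_le_standardParabolicGL_fin_two p.2.2)⟩
  invFun b := (borelDiagGL2 b, borelUnipGL2 b)
  left_inv p := by
    obtain ⟨⟨a₁, a₂⟩, u⟩ := p
    obtain ⟨hut, hud⟩ := (mem_upperUnitriangular_iff (u : GL (Fin 2) R)).1 u.2
    have hd : borelDiagGL2 ⟨diagGL2 a₁ a₂ * (u : GL (Fin 2) R),
        mul_mem (diagGL2_mem_standardParabolicGL _ _) (upperUnitriangular_le_standardParabolicGL_fin_two u.2)⟩ = (a₁, a₂) := by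
      refine Prod.ext (Units.ext ?_) (Units.ext ?_)
      · rw [coe_borelDiagGL2_fst]
        change ((diagGL2 a₁ a₂ * (u : GL (Fin 2) R) : GL (Fin 2) R) : Matrix (Fin 2) (Fin 2) R) 0 0 = a₁
        rw [Units.val_mul, coe_diagGL2, Matrix.mul_apply, Fin.sum_univ_two, hud 0]
        simp
      · rw [coe_borelDiagGL2_snd]
        change ((diagGL2 a₁ a₂ * (u : GL (Fin 2) R) : GL (Fin 2) R) : Matrix (Fin 2) (Fin 2) R) 1 1 = a₂
        rw [Units.val_mul, coe_diagGL2, Matrix.mul_apply, Fin.sum_univ_two, hud 1]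
        simp
    refine Prod.ext hd (Subtype.ext ?_)
    change (diagGL2 (borelDiagGL2 _).1 (borelDiagGL2 _).2)⁻¹ * (diagGL2 a₁ a₂ * (u : GL (Fin 2) R)) = (u : GL (Fin 2) R)
    rw [hd, inv_mul_cancel_left]
  right_inv b := Subtype.ext (diagGL2_mul_borelUnipGL2 b)

/-- `borelCoordGL2 ((a₁,a₂),u) = d(a₁,a₂) u` in `GL₂(R)`. [folklore] -/
@[simp] theorem borelCoordGL2_apply_coe (p : (Rˣ × Rˣ) × ↥(upperUnitriangular (Fin 2) R)) :
    ((borelCoordGL2 p : ↥(standardParabolicGL R (id : Fin 2 → Fin 2))) : GL (Fin 2) R) =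
      diagGL2 p.1.1 p.1.2 * (p.2 : GL (Fin 2) R) := rfl

/-- The inverse coordinates of `b` are `((b₀₀, b₁₁), d(b)⁻¹ b)`. [folklore] -/
theorem borelCoordGL2_symm_apply (b : ↥(standardParabolicGL R (id : Fin 2 → Fin 2))) :
    (borelCoordGL2 (R := R)).symm b = (borelDiagGL2 b, borelUnipGL2 b) := rfl

/-- **The group law in coordinates**: `(d(c) u₀) · (d(a) u) = d(c a) · ((d(a)⁻¹ u₀ d(a)) u)`. [folklore] -/
theorem borelCoordGL2_mul (c a : Rˣ × Rˣ) (u₀ u : ↥(upperUnitriangular (Fin 2) R)) :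
    borelCoordGL2 (c, u₀) * borelCoordGL2 (a, u) = borelCoordGL2 (c * a, torusConjGL2 a u₀ * u) := by
  refine Subtype.ext ?_
  change diagGL2 c.1 c.2 * (u₀ : GL (Fin 2) R) * (diagGL2 a.1 a.2 * (u : GL (Fin 2) R)) =
    diagGL2 (c.1 * a.1) (c.2 * a.2) * (((torusConjGL2 a u₀ * u : ↥(upperUnitriangular (Fin 2) R)) : GL (Fin 2) R))
  rw [Subgroup.coe_mul, diagGL2_mul, coe_torusConjGL2]
  group

section Topology

variable [TopologicalSpace R] [IsTopologicalRing R]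

omit [IsTopologicalRing R] in
/-- `(a, b) ↦ d(a, b)` is continuous into the units topology. [folklore] -/
theorem continuous_diagGL2 : Continuous fun p : Rˣ × Rˣ => diagGL2 p.1 p.2 := by
  refine Units.continuous_iff.2 ⟨?_, ?_⟩
  · have : (Units.val ∘ fun p : Rˣ × Rˣ => diagGL2 p.1 p.2) =
        fun p => !![((p.1 : Rˣ) : R), 0; 0, ((p.2 : Rˣ) : R)] := funext fun p => coe_diagGL2 _ _
    rw [this]
    refine continuous_matrix fun i j => ?_
    fin_cases i <;> fin_cases j <;> simp <;> fun_prop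
  · have : (fun p : Rˣ × Rˣ => (((diagGL2 p.1 p.2)⁻¹ : GL (Fin 2) R) : Matrix (Fin 2) (Fin 2) R)) =
        fun p => !![(((p.1)⁻¹ : Rˣ) : R), 0; 0, (((p.2)⁻¹ : Rˣ) : R)] := funext fun p => by
      rw [diagGL2_inv, coe_diagGL2]
    rw [this]
    refine continuous_matrix fun i j => ?_
    fin_cases i <;> fin_cases j <;> simp <;> fun_prop

/-- `(a, u) ↦ torusConjGL2 a u` is jointly continuous. [folklore] -/
theorem continuous_torusConjGL2 :
    Continuous fun p : (Rˣ × Rˣ) × ↥(upperUnitriangular (Fin 2) R) => torusConjGL2 p.1 p.2 := by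
  unfold torusConjGL2
  refine continuous_unipotentGL2.comp ?_
  refine ((Units.continuous_val.comp (continuous_inv.comp (continuous_fst.comp continuous_fst))).mul
    (continuous_entry_zero_one.comp continuous_snd)).mul (Units.continuous_val.comp (continuous_snd.comp continuous_fst))

/-- `borelDiagGL2` is continuous. [folklore] -/
theorem continuous_borelDiagGL2 :
    Continuous (borelDiagGL2 : ↥(standardParabolicGL R (id : Fin 2 → Fin 2)) → Rˣ × Rˣ) := by
  have hval : Continuous fun b : ↥(standardParabolicGL R (id : Fin 2 → Fin 2)) =>
      ((b : GL (Fin 2) R) : Matrix (Fin 2) (Fin 2) R) := Units.continuous_val.comp continuous_subtype_val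
  have hinv : Continuous fun b : ↥(standardParabolicGL R (id : Fin 2 → Fin 2)) =>
      (((b : GL (Fin 2) R)⁻¹ : GL (Fin 2) R) : Matrix (Fin 2) (Fin 2) R) :=
    Units.continuous_val.comp (continuous_inv.comp continuous_subtype_val)
  refine Continuous.prodMk (Units.continuous_iff.2 ⟨hval.matrix_elem 0 0, hinv.matrix_elem 0 0⟩)
    (Units.continuous_iff.2 ⟨hval.matrix_elem 1 1, hinv.matrix_elem 1 1⟩)

/-- `borelUnipGL2` is continuous. [folklore] -/
theorem continuous_borelUnipGL2 :
    Continuous (borelUnipGL2 : ↥(standardParabolicGL R (id : Fin 2 → Fin 2)) → ↥(upperUnitriangular (Fin 2) R)) :=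
  Continuous.subtype_mk ((continuous_inv.comp (continuous_diagGL2.comp continuous_borelDiagGL2)).mul
    continuous_subtype_val) _

/-- **`B ≅ (Rˣ × Rˣ) × N₂` as topological spaces.** [folklore] -/
def borelHomeomorphGL2 : (Rˣ × Rˣ) × ↥(upperUnitriangular (Fin 2) R) ≃ₜ ↥(standardParabolicGL R (id : Fin 2 → Fin 2)) where
  toEquiv := borelCoordGL2
  continuous_toFun := Continuous.subtype_mk ((continuous_diagGL2.comp continuous_fst).mul
    (continuous_subtype_val.comp continuous_snd)) _
  continuous_invFun := continuous_borelDiagGL2.prodMk continuous_borelUnipGL2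

/-- `borelHomeomorphGL2` is `borelCoordGL2` as a map. [folklore] -/
@[simp] theorem borelHomeomorphGL2_apply (p : (Rˣ × Rˣ) × ↥(upperUnitriangular (Fin 2) R)) :
    borelHomeomorphGL2 p = borelCoordGL2 p := rfl

end Topology

end Ring

/-! ### The module of a unit on an additive Haar measure -/

section Module

variable {G A : Type*} [Group G] [AddCommGroup A] [DistribMulAction G A] [TopologicalSpace A]
  [IsTopologicalAddGroup A] [LocallyCompactSpace A] [ContinuousConstSMul G A]
  [MeasurableSpace A] [BorelSpace A] (μ : Measure A) [μ.IsAddHaarMeasure] [μ.Regular]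

/-- **Push-forward of an additive Haar measure under `x ↦ g • x`**: it is `Δ(g⁻¹) • μ`, where
`Δ = distribHaarChar A` is the module (`μ (g • s) = Δ(g) μ s`, Mathlib `distribHaarChar_mul`).
[folklore] -/
theorem map_constSMul_eq_distribHaarChar_inv_smul (g : G) :
    μ.map (fun x => g • x) = ((distribHaarChar A g⁻¹ : ℝ≥0) : ℝ≥0∞) • μ := by
  refine Measure.ext fun s hs => ?_
  rw [map_apply (measurable_const_smul g) hs, Measure.smul_apply, preimage_smul, smul_eq_mul,
    ← distribHaarChar_mul μ g⁻¹ s]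

/-- `∫⁻ F(g • x) dμ(x) = Δ(g⁻¹) ∫⁻ F dμ`. [folklore] -/
theorem lintegral_comp_constSMul_eq (g : G) {F : A → ℝ≥0∞} (hF : Measurable F) :
    ∫⁻ x, F (g • x) ∂μ = ((distribHaarChar A g⁻¹ : ℝ≥0) : ℝ≥0∞) * ∫⁻ x, F x ∂μ := by
  rw [← smul_eq_mul, ← lintegral_smul_measure, ← map_constSMul_eq_distribHaarChar_inv_smul μ g,
    lintegral_map hF (measurable_const_smul g)]

end Module

/-! ### `GL₂(𝔸_K)`: the Haar measure of the Borel subgroup and the Iwasawa integration formula -/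

section Adelic

variable (K : Type) [Field K] [NumberField K]

/-- `GL₂(𝔸_K)` is Hausdorff, locally compact and second countable (tree results, as local
instances would be; recorded as a conjunction for `haveI`). [folklore] -/
theorem topology_gl2_adele :
    T2Space (GL (Fin 2) (AdeleRing (𝓞 K) K)) ∧ LocallyCompactSpace (GL (Fin 2) (AdeleRing (𝓞 K) K)) ∧
      SecondCountableTopology (GL (Fin 2) (AdeleRing (𝓞 K) K)) := by
  haveI : T2Space (AdeleRing (𝓞 K) K) := t2Space_adeleRing K
  exact ⟨inferInstance, AdelicGroupData.locallyCompactSpace_generalLinearGroup_adeleRing K (Fin 2),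
    secondCountableTopology_generalLinearGroup_adeleRing K (Fin 2)⟩

/-- The Iwasawa decomposition `GL₂(𝔸_K) = B(𝔸_K) · K` in the form consumed by `HaarHK`
(`iwasawaDecomposition_gl_adelic_holds` of `IwasawaDecompositionAdelic`). [folklore] -/
theorem exists_borel_mul_maximalCompact_eq (g : GL (Fin 2) (AdeleRing (𝓞 K) K)) :
    ∃ b ∈ standardParabolicGL (AdeleRing (𝓞 K) K) (id : Fin 2 → Fin 2),
      ∃ k ∈ standardMaximalCompactGL 2 K, g = b * k := by
  have h := iwasawaDecomposition_gl_adelic_holds 2 K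
  have hg : g ∈ (standardParabolicGL (AdeleRing (𝓞 K) K) (id : Fin 2 → Fin 2) :
      Set (GL (Fin 2) (AdeleRing (𝓞 K) K))) * (standardMaximalCompactGL 2 K : Set _) := by
    rw [show ((standardParabolicGL (AdeleRing (𝓞 K) K) (id : Fin 2 → Fin 2) :
      Set (GL (Fin 2) (AdeleRing (𝓞 K) K))) * (standardMaximalCompactGL 2 K : Set _)) = Set.univ from h]
    exact mem_univ g
  obtain ⟨b, hb, k, hk, hbk⟩ := Set.mem_mul.1 hg
  exact ⟨b, hb, k, hk, hbk.symm⟩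

variable [MeasurableSpace (GL (Fin 2) (AdeleRing (𝓞 K) K))] [BorelSpace (GL (Fin 2) (AdeleRing (𝓞 K) K))]
  [MeasurableSpace (AdeleRing (𝓞 K) K)ˣ] [BorelSpace (AdeleRing (𝓞 K) K)ˣ]
  (μI : Measure (AdeleRing (𝓞 K) K)ˣ) [IsHaarMeasure μI]
  (ν : Measure ↥(adelicUnipotent 2 K)) [IsHaarMeasure ν]

/-- **The measure `(μ_I ⊗ μ_I ⊗ ν)` transported to `B(𝔸_K)` along `((a₁,a₂),u) ↦ d(a₁,a₂) u`.**
[folklore] -/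
def borelMeasureGL2 : Measure ↥(standardParabolicGL (AdeleRing (𝓞 K) K) (id : Fin 2 → Fin 2)) :=
  (((μI.prod μI).prod ν).map (borelHomeomorphGL2 (R := AdeleRing (𝓞 K) K)))

/-- Left translations of `(𝔸_Kˣ)² × N₂(𝔸_K)` in Borel coordinates preserve `μ_I ⊗ μ_I ⊗ ν`
(a skew product of a translation of `(𝔸_Kˣ)²` and, fibrewise, left translations of `N₂(𝔸_K)`).
[folklore] -/
theorem measurePreserving_borelCoord_mul (c : (AdeleRing (𝓞 K) K)ˣ × (AdeleRing (𝓞 K) K)ˣ)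
    (u₀ : ↥(adelicUnipotent 2 K)) :
    MeasurePreserving (fun p : ((AdeleRing (𝓞 K) K)ˣ × (AdeleRing (𝓞 K) K)ˣ) × ↥(adelicUnipotent 2 K) =>
        (c * p.1, torusConjGL2 p.1 u₀ * p.2)) ((μI.prod μI).prod ν) ((μI.prod μI).prod ν) := by
  haveI := locallyCompactSpace_ideleGroup K
  haveI := secondCountableTopology_ideleGroup K
  refine (measurePreserving_mul_left (μI.prod μI) c).skew_product
    (g := fun a u => torusConjGL2 a u₀ * u) ?_ ?_
  · exact ((continuous_torusConjGL2.comp (continuous_fst.prodMk continuous_const)).mul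
      continuous_snd).measurable
  · exact Eventually.of_forall fun a => map_mul_left_eq_self ν (torusConjGL2 a u₀)

/-- **`μ_I ⊗ μ_I ⊗ ν` in Borel coordinates is a left Haar measure on `B(𝔸_K)`.** [folklore] -/
instance isHaarMeasure_borelMeasureGL2 : IsHaarMeasure (borelMeasureGL2 K μI ν) := by
  obtain ⟨_, _, _⟩ := topology_gl2_adele K
  haveI := locallyCompactSpace_ideleGroup K
  haveI := secondCountableTopology_ideleGroup K
  set e := borelHomeomorphGL2 (R := AdeleRing (𝓞 K) K) with he_def
  have he : Measurable e := e.continuous.measurable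
  have hμ : borelMeasureGL2 K μI ν = ((μI.prod μI).prod ν).map e := rfl
  -- left invariance
  haveI : (borelMeasureGL2 K μI ν).IsMulLeftInvariant := by
    refine ⟨fun b₀ => ?_⟩
    obtain ⟨⟨c, u₀⟩, rfl⟩ := e.surjective b₀
    rw [hμ, map_map (measurable_const_mul _) he]
    have hcomp : ((e (c, u₀) * ·) ∘ e) = e ∘ fun p => (c * p.1, torusConjGL2 p.1 u₀ * p.2) := by
      funext p
      simp only [Function.comp_apply, he_def, borelHomeomorphGL2_apply]
      exact borelCoordGL2_mul c p.1 u₀ p.2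
    rw [hcomp, ← map_map he (measurePreserving_borelCoord_mul K μI ν c u₀).measurable,
      (measurePreserving_borelCoord_mul K μI ν c u₀).map_eq]
  refine { lt_top_of_isCompact := fun C hC => ?_, open_pos := fun U hU hne => ?_ }
  · rw [hμ, map_apply he hC.measurableSet]
    exact (e.isCompact_preimage.2 hC).measure_lt_top
  · rw [hμ, map_apply he hU.measurableSet]
    exact (hU.preimage e.continuous).measure_ne_zero _ (hne.preimage e.surjective)

/-- Integration against `borelMeasureGL2` in coordinates (Tonelli). [folklore] -/
theorem lintegral_borelMeasureGL2 {F : ↥(standardParabolicGL (AdeleRing (𝓞 K) K) (id : Fin 2 → Fin 2)) → ℝ≥0∞}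
    (hF : Measurable F) :
    ∫⁻ b, F b ∂(borelMeasureGL2 K μI ν) =
      ∫⁻ a₁, ∫⁻ a₂, ∫⁻ u, F (borelCoordGL2 ((a₁, a₂), u)) ∂ν ∂μI ∂μI := by
  haveI := locallyCompactSpace_ideleGroup K
  haveI := secondCountableTopology_ideleGroup K
  have he : Measurable (borelHomeomorphGL2 (R := AdeleRing (𝓞 K) K)) :=
    (borelHomeomorphGL2 (R := AdeleRing (𝓞 K) K)).continuous.measurable
  rw [borelMeasureGL2, lintegral_map hF he,
    lintegral_prod (fun z => F (borelHomeomorphGL2 z)) (hF.comp he).aemeasurable,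
    lintegral_prod (fun a : (AdeleRing (𝓞 K) K)ˣ × (AdeleRing (𝓞 K) K)ˣ =>
      ∫⁻ u, F (borelHomeomorphGL2 (a, u)) ∂ν) ((hF.comp he).lintegral_prod_right').aemeasurable]
  rfl

/-- **The Iwasawa constant** `c > 0` of `μ_G = c · (μ_B ⊗ μ_K)` (`HaarHK.decompConst` for
`G = B K`, `B` closed, `K` compact). [folklore] -/
def iwasawaConstGL2 (μG : Measure (GL (Fin 2) (AdeleRing (𝓞 K) K))) [IsHaarMeasure μG]
    (μK : Measure ↥(standardMaximalCompactGL 2 K)) [IsHaarMeasure μK] : ℝ≥0 :=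
  haveI := (topology_gl2_adele K).1
  haveI := (topology_gl2_adele K).2.1
  haveI := (topology_gl2_adele K).2.2
  haveI : T2Space (AdeleRing (𝓞 K) K) := t2Space_adeleRing K
  HaarHK.decompConst (isClosed_standardParabolicGL_id (R := AdeleRing (𝓞 K) K) (n := 2))
    (isCompact_standardMaximalCompactGL 2 K) (exists_borel_mul_maximalCompact_eq K) μG
    (borelMeasureGL2 K μI ν) μK

/-- `c > 0`. [folklore] -/
theorem iwasawaConstGL2_pos (μG : Measure (GL (Fin 2) (AdeleRing (𝓞 K) K))) [IsHaarMeasure μG]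
    (μK : Measure ↥(standardMaximalCompactGL 2 K)) [IsHaarMeasure μK] : 0 < iwasawaConstGL2 K μI ν μG μK := by
  obtain ⟨_, _, _⟩ := topology_gl2_adele K
  haveI : T2Space (AdeleRing (𝓞 K) K) := t2Space_adeleRing K
  exact HaarHK.decompConst_pos _ _ _ _ _ _

/-- **Haar measure of `GL₂(𝔸_K)` in Iwasawa coordinates.** For left Haar measures `μ_G` on
`GL₂(𝔸_K)`, `μ_I` on `𝔸_Kˣ`, `ν` on `N₂(𝔸_K)` and `μ_K` on `K = K_∞ GL₂(𝒪̂_K)` there is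
`c = iwasawaConstGL2 > 0` with
`∫_G f dμ_G = c ∫_{𝔸ˣ} ∫_{𝔸ˣ} ∫_{N} ∫_K f(d(a₁,a₂) u k) dμ_K dν dμ_I(a₂) dμ_I(a₁)` for every Borel
`f ≥ 0` — `G = B K` (`HaarHK.eq_smul_map_prod`, the compact `K` being unimodular), `B = T ⋉ N`
(`isHaarMeasure_borelMeasureGL2`), `T ≅ 𝔸_Kˣ × 𝔸_Kˣ` (Bump, *Automorphic Forms and
Representations* (1997), Prop. 3.3.? / Getz–Hahn (2024), Ex. 3.1 and Prop. 3.2.3; Godement–Jacquet).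
[folklore] -/
theorem lintegral_eq_iwasawa (μG : Measure (GL (Fin 2) (AdeleRing (𝓞 K) K))) [IsHaarMeasure μG]
    (μK : Measure ↥(standardMaximalCompactGL 2 K)) [IsHaarMeasure μK]
    {f : GL (Fin 2) (AdeleRing (𝓞 K) K) → ℝ≥0∞} (hf : Measurable f) :
    ∫⁻ g, f g ∂μG = (iwasawaConstGL2 K μI ν μG μK : ℝ≥0∞) *
      ∫⁻ a₁, ∫⁻ a₂, ∫⁻ u, ∫⁻ k, f (diagGL2 a₁ a₂ * (u : GL (Fin 2) (AdeleRing (𝓞 K) K)) * (k : GL (Fin 2) (AdeleRing (𝓞 K) K)))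
        ∂μK ∂ν ∂μI ∂μI := by
  obtain ⟨_, _, _⟩ := topology_gl2_adele K
  haveI : T2Space (AdeleRing (𝓞 K) K) := t2Space_adeleRing K
  haveI := locallyCompactSpace_ideleGroup K
  haveI := secondCountableTopology_ideleGroup K
  haveI : CompactSpace ↥(standardMaximalCompactGL 2 K) :=
    isCompact_iff_compactSpace.1 (isCompact_standardMaximalCompactGL 2 K)
  haveI : SecondCountableTopology ↥(standardMaximalCompactGL 2 K) :=
    TopologicalSpace.Subtype.secondCountableTopology _
  haveI := isInvInvariant_of_compactSpace μK
  haveI : IsFiniteMeasure μK := CompactSpace.isFiniteMeasure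
  have hμG := HaarHK.eq_smul_map_prod (isClosed_standardParabolicGL_id (R := AdeleRing (𝓞 K) K) (n := 2))
    (isCompact_standardMaximalCompactGL 2 K) (exists_borel_mul_maximalCompact_eq K) μG (borelMeasureGL2 K μI ν) μK
  have hmeas : Measurable (HaarHK.hkMap (standardParabolicGL (AdeleRing (𝓞 K) K) (id : Fin 2 → Fin 2))
      (standardMaximalCompactGL 2 K)) := HaarHK.continuous_hkMap.measurable
  -- unfold `μ_G = c • a_*(μ_B ⊗ μ_K)`
  have h1 : ∫⁻ g, f g ∂μG = (iwasawaConstGL2 K μI ν μG μK : ℝ≥0∞) *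
      ∫⁻ p, f (HaarHK.hkMap (standardParabolicGL (AdeleRing (𝓞 K) K) (id : Fin 2 → Fin 2))
        (standardMaximalCompactGL 2 K) p) ∂((borelMeasureGL2 K μI ν).prod μK) := by
    conv_lhs => rw [hμG]
    rw [lintegral_smul_measure, lintegral_map hf hmeas]
    rfl
  rw [h1]
  congr 1
  -- Tonelli on `B × K`, inversion invariance of `μ_K`, then Borel coordinates
  rw [lintegral_prod (fun p => f (HaarHK.hkMap (standardParabolicGL (AdeleRing (𝓞 K) K) (id : Fin 2 → Fin 2))
    (standardMaximalCompactGL 2 K) p)) (hf.comp hmeas).aemeasurable]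
  have h2 : ∀ b : ↥(standardParabolicGL (AdeleRing (𝓞 K) K) (id : Fin 2 → Fin 2)),
      ∫⁻ k, f (HaarHK.hkMap (standardParabolicGL (AdeleRing (𝓞 K) K) (id : Fin 2 → Fin 2))
        (standardMaximalCompactGL 2 K) (b, k)) ∂μK =
      ∫⁻ k, f ((b : GL (Fin 2) (AdeleRing (𝓞 K) K)) * (k : GL (Fin 2) (AdeleRing (𝓞 K) K))) ∂μK := by
    intro b
    simp only [HaarHK.hkMap_apply]
    have := lintegral_inv_eq_self (μ := μK)
      (fun k : ↥(standardMaximalCompactGL 2 K) => f ((b : GL (Fin 2) (AdeleRing (𝓞 K) K)) * (k : GL (Fin 2) (AdeleRing (𝓞 K) K))))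
    simpa only [Subgroup.coe_inv] using this
  simp_rw [h2]
  have hF : Measurable fun b : ↥(standardParabolicGL (AdeleRing (𝓞 K) K) (id : Fin 2 → Fin 2)) =>
      ∫⁻ k, f ((b : GL (Fin 2) (AdeleRing (𝓞 K) K)) * (k : GL (Fin 2) (AdeleRing (𝓞 K) K))) ∂μK := by
    refine Measurable.lintegral_prod_right' (f := fun q : ↥(standardParabolicGL (AdeleRing (𝓞 K) K) (id : Fin 2 → Fin 2)) ×
      ↥(standardMaximalCompactGL 2 K) =>
      f ((q.1 : GL (Fin 2) (AdeleRing (𝓞 K) K)) * (q.2 : GL (Fin 2) (AdeleRing (𝓞 K) K)))) ?_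
    exact hf.comp ((continuous_subtype_val.comp continuous_fst).mul
      (continuous_subtype_val.comp continuous_snd)).measurable
  rw [lintegral_borelMeasureGL2 K μI ν hF]
  rfl

/-! ### The modulus of the torus on `N₂(𝔸_K)` -/

variable [MeasurableSpace (AdeleRing (𝓞 K) K)] [BorelSpace (AdeleRing (𝓞 K) K)]
  [LocallyCompactSpace (AdeleRing (𝓞 K) K)]

omit [MeasurableSpace (AdeleRing (𝓞 K) K)ˣ] [BorelSpace (AdeleRing (𝓞 K) K)ˣ] in
/-- **Conjugating `N₂(𝔸_K)` by the torus scales its Haar measure by the module**: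
`∫ F(d(a)⁻¹ u d(a)) dν(u) = Δ(a₁ a₂⁻¹) ∫ F dν`, `Δ` the module of `𝔸_K` (`distribHaarChar`),
since `(d(a)⁻¹ n(x) d(a))₀₁ = (a₁⁻¹ a₂) x` and `ν` corresponds to an additive Haar measure of `𝔸_K`
along `u ↦ u₀₁` (`entryMeasure`). [folklore] -/
theorem lintegral_comp_torusConjGL2 (a : (AdeleRing (𝓞 K) K)ˣ × (AdeleRing (𝓞 K) K)ˣ)
    {F : ↥(adelicUnipotent 2 K) → ℝ≥0∞} (hF : Measurable F) :
    ∫⁻ u, F (torusConjGL2 a u) ∂ν =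
      ((distribHaarChar (AdeleRing (𝓞 K) K) (a.1 * a.2⁻¹) : ℝ≥0) : ℝ≥0∞) * ∫⁻ u, F u ∂ν := by
  haveI := secondCountableTopology_adeleRing K
  -- transport to `𝔸_K`
  have htrans : ∀ {G : ↥(adelicUnipotent 2 K) → ℝ≥0∞}, Measurable G →
      ∫⁻ u, G u ∂ν = ∫⁻ x, G (unipotentGL2 x) ∂(entryMeasure ν) := by
    intro G hG
    rw [entryMeasure, lintegral_map (show Measurable fun x : AdeleRing (𝓞 K) K => G (unipotentGL2 x) from
      hG.comp continuous_unipotentGL2.measurable) measurableEmbedding_entry_zero_one.measurable]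
    refine lintegral_congr fun u => ?_
    simp only [unipotentGL2_entry]
  have hconj : ∀ x : AdeleRing (𝓞 K) K, torusConjGL2 a (unipotentGL2 x) = unipotentGL2 ((a.1⁻¹ * a.2) • x) := by
    intro x
    unfold torusConjGL2
    rw [unipotentGL2_apply_zero_one, Units.smul_def, Units.val_mul, smul_eq_mul]
    congr 1
    ring
  rw [htrans (show Measurable (fun u => F (torusConjGL2 a u)) from
      hF.comp (continuous_torusConjGL2.comp (continuous_const.prodMk continuous_id)).measurable),
    htrans hF]
  simp_rw [hconj]
  rw [lintegral_comp_constSMul_eq (entryMeasure ν) (a.1⁻¹ * a.2) (F := fun x => F (unipotentGL2 x))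
    (hF.comp continuous_unipotentGL2.measurable), _root_.mul_inv_rev, inv_inv, mul_comm a.2⁻¹]

omit [MeasurableSpace (AdeleRing (𝓞 K) K)ˣ] [BorelSpace (AdeleRing (𝓞 K) K)ˣ] in
/-- **The Iwasawa coordinates in the order `N · T · K`**: for Borel `f ≥ 0` on `GL₂(𝔸_K)`,
`∫∫ (∫_N ∫_K f(u d(a) k)) dμ_I² = ∫∫ Δ(a₁/a₂) (∫_N ∫_K f(d(a) u k)) dμ_I²` — the Jacobian
`Δ(a₁/a₂)` of `u ↦ d(a)⁻¹ u d(a)` (in `GL₂(ℝ)`: `dg = y⁻¹ dx d×y₁ d×y₂ dk` for `g = n(x) diag(y₁,y₂) k`,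
`y = y₁/y₂`). [folklore] -/
theorem lintegral_unipotent_torus_eq (μK : Measure ↥(standardMaximalCompactGL 2 K)) [SFinite μK]
    (a : (AdeleRing (𝓞 K) K)ˣ × (AdeleRing (𝓞 K) K)ˣ)
    {f : GL (Fin 2) (AdeleRing (𝓞 K) K) → ℝ≥0∞} (hf : Measurable f) :
    ∫⁻ u, ∫⁻ k, f ((u : GL (Fin 2) (AdeleRing (𝓞 K) K)) * diagGL2 a.1 a.2 * (k : GL (Fin 2) (AdeleRing (𝓞 K) K))) ∂μK ∂ν =
      ((distribHaarChar (AdeleRing (𝓞 K) K) (a.1 * a.2⁻¹) : ℝ≥0) : ℝ≥0∞) *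
        ∫⁻ u, ∫⁻ k, f (diagGL2 a.1 a.2 * (u : GL (Fin 2) (AdeleRing (𝓞 K) K)) * (k : GL (Fin 2) (AdeleRing (𝓞 K) K))) ∂μK ∂ν := by
  have hF : Measurable fun u : ↥(adelicUnipotent 2 K) =>
      ∫⁻ k, f (diagGL2 a.1 a.2 * (u : GL (Fin 2) (AdeleRing (𝓞 K) K)) * (k : GL (Fin 2) (AdeleRing (𝓞 K) K))) ∂μK := by
    refine Measurable.lintegral_prod_right' (f := fun q : ↥(adelicUnipotent 2 K) × ↥(standardMaximalCompactGL 2 K) =>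
      f (diagGL2 a.1 a.2 * (q.1 : GL (Fin 2) (AdeleRing (𝓞 K) K)) * (q.2 : GL (Fin 2) (AdeleRing (𝓞 K) K)))) ?_
    exact hf.comp ((continuous_const.mul (continuous_subtype_val.comp continuous_fst)).mul
      (continuous_subtype_val.comp continuous_snd)).measurable
  rw [← lintegral_comp_torusConjGL2 K ν a hF]
  refine lintegral_congr fun u => lintegral_congr fun k => ?_
  rw [diagGL2_mul_torusConjGL2]

end Adelic

end Literature.NumberTheory.Automorphic
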